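import Summits.HubbardSuperconductivity.HubbardSuperconductivity.Theorems.AnisotropyChordDressHalfFilledSecondOrderUpper
import Summits.HubbardSuperconductivity.HubbardSuperconductivity.Theorems.LevyLogBootstrapDressHalfFilledDictionaryOfData
import HarnessLib

/-!
# Crux `DressHalfFilled` (stmt-HubbardSuperconductivity-8148, routes `AnisotropyChord` / `LevyLogBootstrap`), stub 3
# `stub_dressHalfFilled`: the second-order upper bound IN XXZ FORM — `E ≤ E₀ + t'²·⟨φ, (2J·XXZ(Δ_eff) + k) φ⟩ + O_L(t'³)`

Helper file (`--supports stmt-HubbardSuperconductivity-8148`), continuing `…SecondOrderUpper`. There the quarter-doped (indeed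
every boson-sector) energy of the checkerboard Hubbard torus `H_in + t' T` was bounded by Kato's dressed trial state:
`E ≤ E₀ − t'²·Re⟨T a, S T a⟩ + C t'³`, `a = Φφ`. Clause (d) of the dictionary — in the tree for the concrete
`Φ = dictionaryMap M U` from the (W4) uniqueness clauses and `J ≠ 0` (`…DictionaryOfData.dictionaryMap_kernel_clause_of_unique`,
`M ≥ 3`) — identifies the coefficient: `−⟨a, T S T a⟩ = ⟨φ, (2J(U)·xxzHamiltonian 1 (torusGraph 2 M) (−1) Δ_eff(U) + k(N_b)) φ⟩`.
Hence

* `plaquette_sectorEnergy_le_xxz` — for `M ≥ 3`, `J(U) ≠ 0` and the (W4) clauses: there is `k : ℕ → ℝ` with, for every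
  `N_b ≤ M²`, unit `φ` of the boson sector and `t' ∈ [0,1]`,
  **`E_{(L²−2N_b, 0)}(H_in + t' T) ≤ E₀(N_b) + t'²·Re⟨φ, (2J·XXZ(Δ_eff) + k(N_b)·1) φ⟩ + C(φ)·t'³`** —
  the `O(t'²)` effective plaquette-boson gas IS the XXZ model at the lock-in anisotropy, as a rigorous one-sided energy
  statement at fixed `L` (take `φ` = the XXZ sector ground state to get `E ≤ E₀ + t'²(2J e_XXZ + k) + O_L(t'³)`).

HONEST LABEL: fixed-`L` upper bound only; no lower bound, no statement about ground STATES, nothing uniform in `L`; the crux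
content of stub 3 is untouched; no crux and no summit statement is proved. Sources: T. Kato (1966) II-§2.3 [Kato1966];
W.-F. Tsai, S. A. Kivelson, PRB 73 (2006) 214510, App. A (A1) [TsaiKivelson2006]. No definition, no named fact; sorry-free.
-/

noncomputable section

-- `dupNamespace`: the summit and the problem are both named `HubbardSuperconductivity` (layout D-0022)
set_option linter.dupNamespace false

namespace Summit.HubbardSuperconductivity.HubbardSuperconductivity.Theorems.AnisotropyChord.DressSecond

open Matrix Literature.MathematicalPhysics.QuantumLattice Literature.Probability.LatticeModels
open Literature.MathematicalPhysics.QuantumLattice.TorusPlaquette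
open Summit.HubbardSuperconductivity.HubbardSuperconductivity.Theorems.LevyLogBootstrap (dictionaryMap_kernel_clause_of_unique)
open scoped ComplexOrder

variable {M : ℕ} [NeZero M]

set_option linter.style.longLine false in
/-- **Second-order upper bound in XXZ form.** For `M ≥ 3`, `J(U) ≠ 0` and unique `(4,0)` / `(2,0)` plaquette ground states
(clause (W4) of the plaquette data), there is `k : ℕ → ℝ` such that for every boson number `N_b ≤ M²`, every unit spin
vector `φ` of the sector `S^z_tot = N_b − M²/2` and every `t' ∈ [0, 1]`:
`E_{(L²−2N_b, 0)}(H_in + t' T) ≤ E₀(N_b) + t'²·Re⟨φ, (2J(U)·H_M(Δ_eff(U)) + k(N_b)·1) φ⟩ + C·t'³`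
with `E₀(N_b) = (M² − N_b)E(0h) + N_b E(2h)`, `H_M(Δ) = xxzHamiltonian 1 (torusGraph 2 M) (-1) Δ` and
`C = |Re⟨w, T w⟩| + |Re⟨φ, (2J·H_M(Δ_eff) + k)φ⟩|·‖w‖²`, `w = S T Φφ` (the constant of `plaquette_sectorEnergy_le_second_order`). Kato (1966) II-§2.3; Tsai–Kivelson (2006) App. A (A1).
[folklore] -/
theorem plaquette_sectorEnergy_le_xxz (hM : 3 ≤ M) {U : ℝ} (hJ : (plaquettePairCouplings U).J ≠ 0)
    (h4 : ∀ φ₁ φ₂ : Fock (Orb PlaquetteSite), IsGroundStateInSector (plaquetteHamiltonian U) 4 0 φ₁ →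
      IsGroundStateInSector (plaquetteHamiltonian U) 4 0 φ₂ → ∃ c : ℂ, φ₂ = c • φ₁)
    (h2 : ∀ φ₁ φ₂ : Fock (Orb PlaquetteSite), IsGroundStateInSector (plaquetteHamiltonian U) 2 0 φ₁ →
      IsGroundStateInSector (plaquetteHamiltonian U) 2 0 φ₂ → ∃ c : ℂ, φ₂ = c • φ₁) :
    ∃ k : ℕ → ℝ, ∀ (Nb : ℕ), Nb ≤ M ^ 2 → ∀ (φ : TensorIndex (TorusSite 2 M) 2 → ℂ),
      φ ∈ spinZSector (Λ := TorusSite 2 M) 1 ((Nb : ℝ) - (M : ℝ) ^ 2 / 2) → star φ ⬝ᵥ φ = 1 →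
      ∀ t' ∈ Set.Icc (0:ℝ) 1,
    (hamiltonian (fermionTorusGraph 2 (2 * M) \
          SimpleGraph.comap (fun x : FermionTorus 2 (2 * M) => fun i : Fin 2 => ((ofLex x) i : ℕ) / 2) ⊤) 1 U +
        (t' : ℂ) • hamiltonian (fermionTorusGraph 2 (2 * M) ⊓
          SimpleGraph.comap (fun x : FermionTorus 2 (2 * M) => fun i : Fin 2 => ((ofLex x) i : ℕ) / 2) ⊤) 1 0).minEnergyOn
        (szSector (Λ := FermionTorus 2 (2 * M)) ((2 * M) ^ 2 - 2 * Nb) 0) ≤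
      (((M : ℝ) ^ 2 - Nb) * plaquetteEnergy U 0 + Nb * plaquetteEnergy U 2) +
        t' ^ 2 * (star φ ⬝ᵥ ((((2 * (plaquettePairCouplings U).J : ℝ) : ℂ) •
            xxzHamiltonian 1 (torusGraph 2 M) (-1) (plaquettePairCouplings U).ΔEff + ((k Nb : ℝ) : ℂ) • 1) *ᵥ φ)).re +
        t' ^ 3 * (|(star (reducedResolvent (hamiltonian (fermionTorusGraph 2 (2 * M) \
              SimpleGraph.comap (fun x : FermionTorus 2 (2 * M) => fun i : Fin 2 => ((ofLex x) i : ℕ) / 2) ⊤) 1 U)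
              (((M : ℝ) ^ 2 - Nb) * plaquetteEnergy U 0 + Nb * plaquetteEnergy U 2) *ᵥ
            (hamiltonian (fermionTorusGraph 2 (2 * M) ⊓
              SimpleGraph.comap (fun x : FermionTorus 2 (2 * M) => fun i : Fin 2 => ((ofLex x) i : ℕ) / 2) ⊤) 1 0 *ᵥ
                (dictionaryMap M U *ᵥ φ))) ⬝ᵥ
            (hamiltonian (fermionTorusGraph 2 (2 * M) ⊓
              SimpleGraph.comap (fun x : FermionTorus 2 (2 * M) => fun i : Fin 2 => ((ofLex x) i : ℕ) / 2) ⊤) 1 0 *ᵥ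
              (reducedResolvent (hamiltonian (fermionTorusGraph 2 (2 * M) \
                SimpleGraph.comap (fun x : FermionTorus 2 (2 * M) => fun i : Fin 2 => ((ofLex x) i : ℕ) / 2) ⊤) 1 U)
                (((M : ℝ) ^ 2 - Nb) * plaquetteEnergy U 0 + Nb * plaquetteEnergy U 2) *ᵥ
              (hamiltonian (fermionTorusGraph 2 (2 * M) ⊓
                SimpleGraph.comap (fun x : FermionTorus 2 (2 * M) => fun i : Fin 2 => ((ofLex x) i : ℕ) / 2) ⊤) 1 0 *ᵥ
                  (dictionaryMap M U *ᵥ φ))))).re| +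
          |(star φ ⬝ᵥ ((((2 * (plaquettePairCouplings U).J : ℝ) : ℂ) •
            xxzHamiltonian 1 (torusGraph 2 M) (-1) (plaquettePairCouplings U).ΔEff + ((k Nb : ℝ) : ℂ) • 1) *ᵥ φ)).re| *
            (star (reducedResolvent (hamiltonian (fermionTorusGraph 2 (2 * M) \
                SimpleGraph.comap (fun x : FermionTorus 2 (2 * M) => fun i : Fin 2 => ((ofLex x) i : ℕ) / 2) ⊤) 1 U)
                (((M : ℝ) ^ 2 - Nb) * plaquetteEnergy U 0 + Nb * plaquetteEnergy U 2) *ᵥ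
              (hamiltonian (fermionTorusGraph 2 (2 * M) ⊓
                SimpleGraph.comap (fun x : FermionTorus 2 (2 * M) => fun i : Fin 2 => ((ofLex x) i : ℕ) / 2) ⊤) 1 0 *ᵥ
                  (dictionaryMap M U *ᵥ φ))) ⬝ᵥ
              (reducedResolvent (hamiltonian (fermionTorusGraph 2 (2 * M) \
                SimpleGraph.comap (fun x : FermionTorus 2 (2 * M) => fun i : Fin 2 => ((ofLex x) i : ℕ) / 2) ⊤) 1 U)
                (((M : ℝ) ^ 2 - Nb) * plaquetteEnergy U 0 + Nb * plaquetteEnergy U 2) *ᵥ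
              (hamiltonian (fermionTorusGraph 2 (2 * M) ⊓
                SimpleGraph.comap (fun x : FermionTorus 2 (2 * M) => fun i : Fin 2 => ((ofLex x) i : ℕ) / 2) ⊤) 1 0 *ᵥ
                  (dictionaryMap M U *ᵥ φ)))).re) := by
  obtain ⟨k, hk⟩ := dictionaryMap_kernel_clause_of_unique (M := M) hJ h4 h2 hM
  refine ⟨k, fun Nb hNb φ hφ hφ1 t' ht => ?_⟩
  have hM2 : 2 ≤ M := le_trans (by norm_num) hM
  have hup := plaquette_sectorEnergy_le_second_order hM2 U hNb hφ hφ1 ht.1 ht.2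
  -- clause (d) at `φ' = φ`, energies `C.E = plaquetteEnergy` definitionally
  have hd := hk Nb hNb φ φ hφ hφ
  have hT := (hamiltonian_isHermitian_and_commute_holds (fermionTorusGraph 2 (2 * M) ⊓
    SimpleGraph.comap (fun x : FermionTorus 2 (2 * M) => fun i : Fin 2 => ((ofLex x) i : ℕ) / 2) ⊤) 1 0).1
  -- `⟨a, (T S T) a⟩ = ⟨T a, S T a⟩` (energies `C.E = plaquetteEnergy` definitionally)
  have hmove : star (dictionaryMap M U *ᵥ φ) ⬝ᵥ ((hamiltonian (fermionTorusGraph 2 (2 * M) ⊓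
          SimpleGraph.comap (fun x : FermionTorus 2 (2 * M) => fun i : Fin 2 => ((ofLex x) i : ℕ) / 2) ⊤) 1 0 *
          reducedResolvent (hamiltonian (fermionTorusGraph 2 (2 * M) \
            SimpleGraph.comap (fun x : FermionTorus 2 (2 * M) => fun i : Fin 2 => ((ofLex x) i : ℕ) / 2) ⊤) 1 U)
            (((M : ℝ) ^ 2 - (Nb : ℝ)) * (plaquettePairCouplings U).E 0 + (Nb : ℝ) * (plaquettePairCouplings U).E 2) *
          hamiltonian (fermionTorusGraph 2 (2 * M) ⊓
            SimpleGraph.comap (fun x : FermionTorus 2 (2 * M) => fun i : Fin 2 => ((ofLex x) i : ℕ) / 2) ⊤) 1 0) *ᵥ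
        (dictionaryMap M U *ᵥ φ)) =
      star (hamiltonian (fermionTorusGraph 2 (2 * M) ⊓
          SimpleGraph.comap (fun x : FermionTorus 2 (2 * M) => fun i : Fin 2 => ((ofLex x) i : ℕ) / 2) ⊤) 1 0 *ᵥ
            (dictionaryMap M U *ᵥ φ)) ⬝ᵥ
        (reducedResolvent (hamiltonian (fermionTorusGraph 2 (2 * M) \
            SimpleGraph.comap (fun x : FermionTorus 2 (2 * M) => fun i : Fin 2 => ((ofLex x) i : ℕ) / 2) ⊤) 1 U)
            (((M : ℝ) ^ 2 - Nb) * plaquetteEnergy U 0 + Nb * plaquetteEnergy U 2) *ᵥ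
          (hamiltonian (fermionTorusGraph 2 (2 * M) ⊓
            SimpleGraph.comap (fun x : FermionTorus 2 (2 * M) => fun i : Fin 2 => ((ofLex x) i : ℕ) / 2) ⊤) 1 0 *ᵥ
              (dictionaryMap M U *ᵥ φ))) := by
    rw [← mulVec_mulVec, ← mulVec_mulVec, RayleighBottom.star_dotProduct_mulVec_eq, hT.eq]
    rfl
  rw [hmove] at hd
  rw [hd, Complex.neg_re, abs_neg] at hup
  linarith

end Summit.HubbardSuperconductivity.HubbardSuperconductivity.Theorems.AnisotropyChord.DressSecond

end
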